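import Summits.CriticalPhenomena.PercolationContinuityZ3.Theorems.Transplant.SharpnessCriticalProbOne
import Literature.Probability.Percolation.SiteConnectionTools
import Mathlib.Algebra.Order.Group.Action.End
import Mathlib.Algebra.Group.Action.Pretransitive
import HarnessLib

/-!
# Transplant sharpness I (supplement) — the ladder `ℤ × K₂` is vertex-transitive

builds on p205010 (kernel theorem, internal audit signed; external expert review pending).
Status sentence (coordinator 2026-08-20T04:30Z): "θ(p_c) = 0 on ℤ^d, all d ≥ 2 — kernel-verified (Lean 4/Mathlib,
standard axioms); internal adversarial audit SIGNED 2026-08-20 04:29Z; external expert review pending."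

Lane `prim-bschramm`, seat p5; memo `run/shared/lean/prim/bschramm/P5-SHARPNESS.md` §2 row 2, §7.  Supplement to
`Transplant/SharpnessCriticalProbOne.lean` (`TransplantSharpness.ladder_witness`: the ladder `ℤ □ K₂` is connected with
`p_c = 1` and `θ(p_c) = 1`): here we add that its automorphism group acts TRANSITIVELY on the vertices, in Mathlib's
spelling `MulAction.IsPretransitive (G ≃g G) V` (the binder of `Transplant.BenjaminiSchramm1996_conj4_transitive`), so that
the ladder meets EVERY hypothesis of Benjamini–Schramm's Conjecture 4 except `p_c < 1` — a second transitive witness,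
different from `ℤ` itself, that the proviso cannot be dropped (the negation of the proviso-free transitive conjecture is
already the tree's `Transplant.not_conj4_transitive_without_criticalProb_lt_one`, via `ℤ`; not restated here).
Automorphisms used: translations of the line (`zdShiftIso`) times permutations of the rung (`SimpleGraph.Iso.completeGraph`).
Everything is PROVED; no definitions.

References: I. Benjamini, O. Schramm, Electron. Comm. Probab. 1 (1996), Conj. 4 ("assuming `p_c < 1`") and §2.
-/

noncomputable section

namespace Summit.CriticalPhenomena.PercolationContinuityZ3.Theorems.TransplantSharpness

open Literature.Probability.Percolation Literature.Probability.LatticeModels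

/-- `ℤ □ K_W` (`K_W = ⊤` the complete graph on `W`, e.g. the ladder `ℤ × K₂`) is vertex-transitive — its automorphism group acts
transitively (Mathlib's `MulAction.IsPretransitive` for the tautological action `γ • v = γ v`): translate the line, permute the rung;
the automorphism is the product `Equiv.prodCongr` of `zdShiftIso (y.1 - x.1)` and the transposition `Equiv.swap x.2 y.2` of `K_W`.
[folklore] -/
theorem isPretransitive_aut_intLine_boxProd_top (W : Type) [DecidableEq W] :
    MulAction.IsPretransitive (zdGraph 1 □ (⊤ : SimpleGraph W) ≃g zdGraph 1 □ (⊤ : SimpleGraph W)) (Site 1 × W) := by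
  refine ⟨fun x y => ?_⟩
  let φ : zdGraph 1 ≃g zdGraph 1 := zdShiftIso (y.1 - x.1)
  let ψ : (⊤ : SimpleGraph W) ≃g (⊤ : SimpleGraph W) := SimpleGraph.Iso.completeGraph (Equiv.swap x.2 y.2)
  let γ : zdGraph 1 □ (⊤ : SimpleGraph W) ≃g zdGraph 1 □ (⊤ : SimpleGraph W) :=
    { toEquiv := Equiv.prodCongr φ.toEquiv ψ.toEquiv
      map_rel_iff' := by
        intro u v
        simp only [Equiv.prodCongr_apply, Prod.map, SimpleGraph.boxProd_adj]
        rw [show (φ.toEquiv u.1 = φ.toEquiv v.1) = (u.1 = v.1) from propext φ.toEquiv.apply_eq_iff_eq,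
          show (ψ.toEquiv u.2 = ψ.toEquiv v.2) = (u.2 = v.2) from propext ψ.toEquiv.apply_eq_iff_eq]
        exact or_congr (and_congr φ.map_rel_iff' Iff.rfl) (and_congr ψ.map_rel_iff' Iff.rfl) }
  refine ⟨γ, ?_⟩
  show γ x = y
  refine Prod.ext ?_ ?_
  · show x.1 + (y.1 - x.1) = y.1
    abel
  · show Equiv.swap x.2 y.2 x.2 = y.2
    exact Equiv.swap_apply_left _ _

/-- **The ladder `ℤ × K₂` meets every hypothesis of Benjamini–Schramm's Conjecture 4 except `p_c < 1`** — connected, locally finite,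
vertex-transitive under its automorphism group (Mathlib spelling) — and has `p_c = 1`, `θ(p_c) = 1`.
[cite: BenjaminiSchramm1996, Conj. 4 ("assuming p_c < 1")] -/
theorem ladder_transitive_witness :
    (zdGraph 1 □ (⊤ : SimpleGraph (Fin 2))).Connected ∧
      MulAction.IsPretransitive (zdGraph 1 □ (⊤ : SimpleGraph (Fin 2)) ≃g zdGraph 1 □ (⊤ : SimpleGraph (Fin 2))) (Site 1 × Fin 2) ∧
        criticalProb (zdGraph 1 □ (⊤ : SimpleGraph (Fin 2))) ((0 : Site 1), (0 : Fin 2)) = 1 ∧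
          theta (zdGraph 1 □ (⊤ : SimpleGraph (Fin 2))) ((0 : Site 1), (0 : Fin 2))
            (criticalProbIOf (zdGraph 1 □ (⊤ : SimpleGraph (Fin 2))) ((0 : Site 1), (0 : Fin 2))) = 1 :=
  ⟨ladder_witness.1, isPretransitive_aut_intLine_boxProd_top (Fin 2), ladder_witness.2.1, ladder_witness.2.2⟩

end Summit.CriticalPhenomena.PercolationContinuityZ3.Theorems.TransplantSharpness

end
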